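import Summits.QuantumFields.YangMills.Theorems.BalabanUVNodesN15CurvedGluingCubeSmoothCutDressed
import Summits.QuantumFields.YangMills.Theorems.BalabanUVNodesN15CurvedGluingCubeDressedGeneralRemainderRow
import HarnessLib

/-!
# Route «BalabanUVNodes» (cluster K4 «SpineRates»), Track-A DAG node N15 = NE2, BACKGROUND LAYER — THE DRESSED SMOOTH-CUT CUBE's REMAINDER ROW BY NAME: dag-n15-w4's input-localized row
# `[Σ∇*∇ + W + N_L − 𝒱, M_h]∘X ≤ 1_S(y′)·θ₀e^{−ρ₃d}` (`hasMaj_commOp_cubeOp_dressedV_in`) run at `G₀ := M_{χ̃}N_□`, its flat-piece hypotheses discharged from FILE 63's cut rows and the bump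
# (files 31∕34): file 32's `hK` row for the live-background knit

Cell `pub-ymgap`, seat `pub-ymgap-dag-n15-w3` (WIDTH SEAT 3∕3 on node N15, director-ym №197 ∕ HUMAN RULING D-0149; plan `W-SEAT-START-LIST.md` §n15 item 3 «LG-vector + background layers at
GENERAL small-field U» — thirty-eighth piece).  `bears_on: R4∕N15 · K3⁷ SpineGivenEndpointR13SepCoPH (stmt-QuantumFields-20544)`.  Filed `--kind proof --supports stmt-QuantumFields-20544 --as
helper` — COUNT-NEUTRAL.  Theorems only; 0 `sorry`.  Imports BY NAME file 34 `…SmoothCutDressed` (`hasMaj_smoothCut_flat`, `hasMaj_jet_smoothCut_flat`, `jet_smoothCut_out`; file 31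
`smoothCut_out`, `smoothCut_in`) and dag-n15-w4's `…CubeDressedGeneralRemainderRow` (`hasMaj_commOp_cubeOp_dressedV_in`); nothing in the tree is modified; nothing of dag-n15-w4's restated.

WHY.  File 32's gluing with defects reads each cube through three rows: the cut letter (file 34), the locality defect (file 33) and the INPUT-localized remainder row `hK`.  The latter is
dag-n15-w4 g2's `hasMaj_commOp_cubeOp_dressedV_in` for the general dressed cube; at `G₀ = M_χ̃N_□` its flat-piece hypotheses (`hG, hD, hGχ, hDχ, hGψ, hDq, hDqf, hDqb`) are file 31∕34's
outputs and `rfl`s.  ★★★ `hasMaj_commOp_cubeOp_smoothCutDressed_in` performs that instantiation once (the partition data `c₁, c₂, ℓ, ω, d₁`, the `W`-row `θ_W`, the nonlocal letter `c_N`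
and `V̂`'s letter stay displayed exactly as in dag-n15-w4's theorem; `β ↦ β̄ = β + (β₁ + c̃β)`).

HONEST FRAMING ∕ LIMITS.  Pure instantiation; nothing of [B5]∕[B6]∕[B9] asserted ((1.120)–(1.128) pp.37–38, (2.91)–(2.92) p.239, (2.133)–(2.134) p.247, (3.62)–(3.65) pp.402–403 = SHAPES ∕
MECHANISM).  NE2⁺ NOT PRINTED, NOT proved; N15 NOT discharged; counts of record UNMOVED (typed 28∕28 · discharged 5∕27); one finite 𝕋⁴ at fixed ε — NOT infinite volume, NOT OS on ℝ⁴, NOT a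
mass gap, NOT Clay; R4 closes the conditional finite-𝕋⁴ rung `BalabanLadder.UV` only.
-/

set_option autoImplicit false

noncomputable section
open scoped BigOperators
open Finset

namespace Summit.QuantumFields.YangMills.BalabanUVNodes.N15.CurvedSpecies

open Literature.MathematicalPhysics.QuantumFieldTheory.Balaban1983to89
open Literature.MathematicalPhysics.QuantumFieldTheory.Balaban1983to89.B11SectG (BlockNorm HasMaj RowSum)
open Literature.MathematicalPhysics.QuantumFieldTheory.Balaban1983to89.B6RandomWalk (Triangle254)
open Literature.MathematicalPhysics.QuantumFieldTheory.Balaban1983to89.B6Prop26Gluing (mulOp mulOp_apply ind ind_nonneg)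
open Summit.QuantumFields.YangMills.BalabanUVNodes.N15.MatrixSpecies (liftBlk liftEquiv liftEquiv_apply liftEquiv_symm_apply)
open Summit.QuantumFields.YangMills.BalabanUVNodes.N15.BackgroundLayer (fgrad bgrad fgradAdj stack projO blkPair bgPropV projO_none_comp_stack projO_some_comp_stack)
open Summit.QuantumFields.YangMills.BalabanUVNodes.N15.Gluing (commOp lapOp)

variable {X ι J : Type} [Fintype X] [DecidableEq X] [Fintype ι] [DecidableEq ι] [Fintype J] [DecidableEq J] {g : B6.Geometry} (blk : X → g.Site) (τ : J → X ≃ X) (n : ℝ)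
  {σ cr : ℝ} {N : (X × ι → ℝ) →ₗ[ℝ] (X × ι → ℝ)} {V : ((X × ι) × Option (J ⊕ J) → ℝ) →ₗ[ℝ] (X × ι → ℝ)} {χX χtX ψX : X → ℝ} {S : Set g.Site} {β β₁ ct δ : ℝ}

/-- ★★★ **FILE 32's `hK` ROW FOR THE DRESSED SMOOTH-CUT CUBE** — dag-n15-w4's `hasMaj_commOp_cubeOp_dressedV_in` at `G₀ := M_χ̃N_□`: FILE 63's cut rows (`β, β₁`), the bump (`|χ̃| ≤ 1`, `|∇^±χ̃| ≤ c̃`,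
insertions both ways), `N = NM_ψ`, the partition `h` (`c₁, c₂`, block reading `hb` with `ℓ, ω`, one-step block distance `d₁`), the cube operator's local zero-order part through its row `hW`,
its nonlocal part through `[N_L, M_h] ≤ c_Ne^{−ρ_Nd}`, the perturbation `V̂ ≤ Re^{−δ_Vd}`, `β̄Rc_r² < 1` ⟹
`[Σ_μ∇*_μ∇_μ + W + N_L − V̂∘jet, M_h]∘X ≤ 1_S(y′)·θ₀(β̄)·e^{−ρ₃d}` with dag-n15-w4's constant at `β := β̄`. [cite: Balaban1984PropagatorsII, (2.91)–(2.92) p.239, (2.133)–(2.134) p.247 (mechanism); Balaban1984PropagatorsI, (1.120)–(1.128) pp.37–38; Balaban1985BackgroundPropagators, (3.62)–(3.65) pp.402–403] -/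
theorem hasMaj_commOp_cubeOp_smoothCutDressed_in (htri : Triangle254 g) (hd : ∀ a b : g.Site, 0 ≤ g.dist a b) (hsymm : ∀ y y', g.dist y y' = g.dist y' y) (hrow : RowSum g σ cr)
    (hσ : 0 ≤ σ) {ρ₁ ρ₂ ρ₃ ρN δV ε R c₁ c₂ θW cN ℓ ω d₁ : ℝ} (hβ : 0 ≤ β) (hβ₁ : 0 ≤ β₁) (hct : 0 ≤ ct) (hR : 0 ≤ R) (hcr : 0 ≤ cr) (hσρ : σ ≤ ρ₁) (hρ₁V : ρ₁ ≤ δV)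
    (hρ₁G : ρ₁ + σ ≤ δ) (hρ₂ : 0 ≤ ρ₂) (hρ₂₁ : ρ₂ + σ ≤ ρ₁) (hρ₃ : 0 ≤ ρ₃) (hρ₃₂ : ρ₃ ≤ ρ₂) (hρ₃V : ρ₃ + σ ≤ δV - ε) (hρ₃N : ρ₃ + σ ≤ ρN) (hε : 0 < ε) (hc₁ : 0 ≤ c₁)
    (hc₂ : 0 ≤ c₂) (hθW : 0 ≤ θW) (hcN : 0 ≤ cN) (hℓ : 0 ≤ ℓ) (hω : 0 ≤ ω) (hd₁ : 0 ≤ d₁)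
    (hSχ : ∀ x, χX x ≠ 0 → blk x ∈ S) (hSψ : ∀ x, ψX x ≠ 0 → blk x ∈ S) (hχt : ∀ x, |χtX x| ≤ 1)
    (hdχt : ∀ μ p, |fgrad n (liftEquiv (τ μ) ι) (fun p : X × ι => χtX p.1) p| ≤ ct) (hdχtb : ∀ μ p, |bgrad n (liftEquiv (τ μ) ι) (fun p : X × ι => χtX p.1) p| ≤ ct)
    (hsub : mulOp (fun p : X × ι => χtX p.1) ∘ₗ mulOp (fun p : X × ι => χX p.1) = mulOp (fun p : X × ι => χtX p.1))
    (hχ : mulOp (fun p : X × ι => χX p.1) ∘ₗ mulOp (fun p : X × ι => χtX p.1) = mulOp (fun p : X × ι => χtX p.1))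
    (hs : ∀ μ, mulOp ((fun p : X × ι => χtX p.1) ∘ (liftEquiv (τ μ) ι)) ∘ₗ mulOp (fun p : X × ι => χX p.1) = mulOp ((fun p : X × ι => χtX p.1) ∘ (liftEquiv (τ μ) ι)))
    (hsb : ∀ μ, mulOp ((fun p : X × ι => χtX p.1) ∘ (liftEquiv (τ μ) ι).symm) ∘ₗ mulOp (fun p : X × ι => χX p.1) = mulOp ((fun p : X × ι => χtX p.1) ∘ (liftEquiv (τ μ) ι).symm))
    (hdd : ∀ μ, mulOp (fgrad n (liftEquiv (τ μ) ι) (fun p : X × ι => χtX p.1)) ∘ₗ mulOp (fun p : X × ι => χX p.1) = mulOp (fgrad n (liftEquiv (τ μ) ι) (fun p : X × ι => χtX p.1)))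
    (hddb : ∀ μ, mulOp (bgrad n (liftEquiv (τ μ) ι) (fun p : X × ι => χtX p.1)) ∘ₗ mulOp (fun p : X × ι => χX p.1) = mulOp (bgrad n (liftEquiv (τ μ) ι) (fun p : X × ι => χtX p.1)))
    (hs' : ∀ μ, mulOp (fun p : X × ι => χX p.1) ∘ₗ mulOp ((fun p : X × ι => χtX p.1) ∘ (liftEquiv (τ μ) ι)) = mulOp ((fun p : X × ι => χtX p.1) ∘ (liftEquiv (τ μ) ι)))
    (hsb' : ∀ μ, mulOp (fun p : X × ι => χX p.1) ∘ₗ mulOp ((fun p : X × ι => χtX p.1) ∘ (liftEquiv (τ μ) ι).symm) = mulOp ((fun p : X × ι => χtX p.1) ∘ (liftEquiv (τ μ) ι).symm))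
    (hdd' : ∀ μ, mulOp (fun p : X × ι => χX p.1) ∘ₗ mulOp (fgrad n (liftEquiv (τ μ) ι) (fun p : X × ι => χtX p.1)) = mulOp (fgrad n (liftEquiv (τ μ) ι) (fun p : X × ι => χtX p.1)))
    (hddb' : ∀ μ, mulOp (fun p : X × ι => χX p.1) ∘ₗ mulOp (bgrad n (liftEquiv (τ μ) ι) (fun p : X × ι => χtX p.1)) = mulOp (bgrad n (liftEquiv (τ μ) ι) (fun p : X × ι => χtX p.1)))
    (hNψ : N ∘ₗ mulOp (fun p : X × ι => ψX p.1) = N)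
    (hcut : HasMaj (BlockNorm.ofBlocks g (liftBlk blk ι)) (BlockNorm.ofBlocks g (liftBlk blk ι)) (mulOp (fun p : X × ι => χX p.1) ∘ₗ N)
      (fun y y' => ind S y * ind S y' * (β * Real.exp (-(δ * g.dist y y')))))
    (hcutF : ∀ μ, HasMaj (BlockNorm.ofBlocks g (liftBlk blk ι)) (BlockNorm.ofBlocks g (liftBlk blk ι)) (mulOp (fun p : X × ι => χX p.1) ∘ₗ (fgrad n (liftEquiv (τ μ) ι) ∘ₗ N))
      (fun y y' => ind S y * ind S y' * (β₁ * Real.exp (-(δ * g.dist y y')))))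
    (hcutB : ∀ μ, HasMaj (BlockNorm.ofBlocks g (liftBlk blk ι)) (BlockNorm.ofBlocks g (liftBlk blk ι)) (mulOp (fun p : X × ι => χX p.1) ∘ₗ (bgrad n (liftEquiv (τ μ) ι) ∘ₗ N))
      (fun y y' => ind S y * ind S y' * (β₁ * Real.exp (-(δ * g.dist y y')))))
    (hV : HasMaj (BlockNorm.ofBlocks g (blkPair (liftBlk blk ι))) (BlockNorm.ofBlocks g (liftBlk blk ι)) V (fun y y' => R * Real.exp (-(δV * g.dist y y'))))
    (hq : (β + (β₁ + ct * β)) * (R * cr) * cr < 1) {W NL : (X × ι → ℝ) →ₗ[ℝ] (X × ι → ℝ)} {h : X × ι → ℝ} {hb : g.Site → ℝ}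
    (hh1 : ∀ μ p, |fgrad n (liftEquiv (τ μ) ι) h p| ≤ c₁) (hh1b : ∀ μ p, |bgrad n (liftEquiv (τ μ) ι) h p| ≤ c₁)
    (hh2 : ∀ μ p, |fgradAdj n (liftEquiv (τ μ) ι) (fgrad n (liftEquiv (τ μ) ι) h) p| ≤ c₂)
    (hLip : ∀ y y', |hb y - hb y'| ≤ ℓ * g.dist y y') (hrh : ∀ p, |h p - hb (liftBlk blk ι p)| ≤ ω) (hstep : ∀ μ x, g.dist (blk (τ μ x)) (blk x) ≤ d₁)
    (hW : HasMaj (BlockNorm.ofBlocks g (liftBlk blk ι)) (BlockNorm.ofBlocks g (liftBlk blk ι))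
      (commOp W h ∘ₗ (projO none ∘ₗ bgPropV (stack (mulOp (fun p : X × ι => χtX p.1) ∘ₗ N)
        (fun j => Sum.elim (fun μ => fgrad n (liftEquiv (τ μ) ι)) (fun μ => bgrad n (liftEquiv (τ μ) ι)) j ∘ₗ (mulOp (fun p : X × ι => χtX p.1) ∘ₗ N))) V))
      (fun y y' => ind S y * ind S y' * (θW * Real.exp (-(ρ₂ * g.dist y y')))))
    (hKN : HasMaj (BlockNorm.ofBlocks g (liftBlk blk ι)) (BlockNorm.ofBlocks g (liftBlk blk ι)) (commOp NL h) (fun y y' => cN * Real.exp (-(ρN * g.dist y y')))) :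
    HasMaj (BlockNorm.ofBlocks g (liftBlk blk ι)) (BlockNorm.ofBlocks g (liftBlk blk ι))
      (commOp (lapOp n (fun μ => liftEquiv (τ μ) ι) W + NL
          - V ∘ₗ stack LinearMap.id (fun j => Sum.elim (fun μ => fgrad n (liftEquiv (τ μ) ι)) (fun μ => bgrad n (liftEquiv (τ μ) ι)) j)) h ∘ₗ
        (projO none ∘ₗ bgPropV (stack (mulOp (fun p : X × ι => χtX p.1) ∘ₗ N)
          (fun j => Sum.elim (fun μ => fgrad n (liftEquiv (τ μ) ι)) (fun μ => bgrad n (liftEquiv (τ μ) ι)) j ∘ₗ (mulOp (fun p : X × ι => χtX p.1) ∘ₗ N))) V))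
      (fun y y' => ind S y' * (((Fintype.card J * (c₂ * ((β + (β₁ + ct * β)) * (1 - (β + (β₁ + ct * β)) * (R * cr) * cr)⁻¹) +
            2 * (c₁ * ((β + (β₁ + ct * β)) * (1 - (β + (β₁ + ct * β)) * (R * cr) * cr)⁻¹))) + θW
          + cN * ((β + (β₁ + ct * β)) * (1 - (β + (β₁ + ct * β)) * (R * cr) * cr)⁻¹) * cr)
          + ((ℓ * (Real.exp 1 * ε)⁻¹ + 2 * (ω + ℓ * d₁)) * R * ((β + (β₁ + ct * β)) * (1 - (β + (β₁ + ct * β)) * (R * cr) * cr)⁻¹) * cr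
            + R * c₁ * ((β + (β₁ + ct * β)) * (1 - (β + (β₁ + ct * β)) * (R * cr) * cr)⁻¹) * cr)) *
          Real.exp (-(ρ₃ * g.dist y y')))) := by
  have hβb : 0 ≤ β + (β₁ + ct * β) := by positivity
  have hG := hasMaj_smoothCut_flat blk (S := S) hβ hβ₁ hct hχt hsub hcut
  have hD := hasMaj_jet_smoothCut_flat blk τ n (S := S) hβ hβ₁ hct hχt hdχt hdχtb hs hsb hdd hddb hcut hcutF hcutB
  have hDχ : ∀ j, mulOp (fun p : X × ι => χX p.1) ∘ₗ (Sum.elim (fun μ => fgrad n (liftEquiv (τ μ) ι)) (fun μ => bgrad n (liftEquiv (τ μ) ι)) j ∘ₗ (mulOp (fun p : X × ι => χtX p.1) ∘ₗ N)) =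
      Sum.elim (fun μ => fgrad n (liftEquiv (τ μ) ι)) (fun μ => bgrad n (liftEquiv (τ μ) ι)) j ∘ₗ (mulOp (fun p : X × ι => χtX p.1) ∘ₗ N) :=
    jet_smoothCut_out τ n (N := N) hs hsb hdd hddb hs' hsb' hdd' hddb'
  exact hasMaj_commOp_cubeOp_dressedV_in blk τ n htri hd hsymm hrow hσ hβb hR hcr hσρ hρ₁V hρ₁G hρ₂ hρ₂₁ hρ₃ hρ₃₂ hρ₃V hρ₃N hε hc₁ hc₂ hθW hcN hℓ hω hd₁ (fun _ => rfl) (fun _ => rfl)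
    (fun _ => rfl) hSχ hSψ (smoothCut_out hχ) hDχ (smoothCut_in hNψ) hh1 hh1b hh2 hLip hrh hstep hG hD hV hq hW hKN

end Summit.QuantumFields.YangMills.BalabanUVNodes.N15.CurvedSpecies

end
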